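import Summits.CriticalPhenomena.PercolationContinuityZ3.Theorems.PercNearOneGluingNoHeavyConstsTripleSplitPlusCount
import Literature.Probability.Percolation.TwoClusterGibbsSampler
import Literature.Probability.Percolation.KozmaNitzanSeparatingTriple
import Literature.Probability.Percolation.FoldingFibres
import HarnessLib

/-!
# The cluster-square inequality: a two-copy sufficient condition for the rooted split inequality (DUU)

builds on p205010 (kernel theorem, internal audit signed; external expert review pending)

PAPER-2 track "percolation constants", part (ii), seat `prim-consts-1`, gen 15 (lane index
`run/shared/lean/prim/consts/CONSTANTS.md`, row A19; memo `FROM-prim-consts-1-g15-CLUSTER-SQUARE.md`).  Support file for the crux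
`NoHeavyLowerTail` (stmt-CriticalPhenomena-4575; `--supports`): one `Prop` definition (an OPEN statement, tagged `@[conjecture]`),
two auxiliary real-valued definitions, and theorems; no sorries; standard axioms.  Nothing here claims the conjecture.

Notation (terminals `a, b, c` of a finite weighted graph, `μ = prodBernoulli w`): `X = a|b|c`, `D_a = {a ↮ b, a ↮ c}`,
`U_bc = {b ↮ c}`, `s = μ(X)`, `D = μ(D_a)`, `U = μ(U_bc)`; `C_a` the open cluster of `a` and, for a configuration `ω`,
`u(ω) := μ{η : b ↮ c in η with every pair meeting {a} ∪ V(C_a(ω)) deleted}` — the probability that `b` and `c` are separated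
in a FRESH configuration on the graph with the cluster of `a` (of `ω`) removed (`Consts.sepOffCluster`).

THE POINT.  Conditioning on the cluster of `a` (van den Berg–Häggström–Kahn's Lemma 2.4 at `q = 1`, tree lemma
`BHK2006.set_sum_cond_cluster`) gives the tower identity `s = ∫_{D_a} u dμ` (`Consts.real_split_eq_setIntegral_sepOffCluster`), and the
Cauchy–Schwarz inequality over the cluster of `a` — exactly the mechanism of Gladkov's Theorem 5.2 (Cauchy–Schwarz over the leaves of
the decision tree exploring `C_a`) — gives the KERNEL inequality
  `s² ≤ D · T`,  `T := ∫_{D_a} u² dμ = Σ_K P(C_a = K) · μ_{G−K}(b ↮ c)²`  (`Consts.sq_real_split_le_real_mul_clusterSquare`).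
Hence the rooted split inequality DUU `s² ≤ D·U²` (`Consts.RootedSplit`, gen 8), and with it the triple-split inequality TS
(`Consts.TripleSplit`, gen 6), FOLLOW from the
* **CONJECTURE (CSQ) `Consts.ClusterSquareSplit`**: `T ≤ U²`, i.e. `Σ_K P(C_a = K, K ∌ b, c) · μ_{G−K}(b ↮ c)² ≤ μ_G(b ↮ c)²`; in
  two-configuration form: for independent `η, ω'' ~ μ`, `P(η ∈ a|b|c and b ↮ c in ω'' off C_a(η)) ≤ P(b ↮ c)²`
  (`Consts.rootedSplit_of_clusterSquareSplit`, `Consts.tripleSplit_of_clusterSquareSplit`).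
Why CSQ rather than DUU.  (i) Every summand has `μ_{G−K}(b↮c) ≥ U`, so CSQ says that `a`'s cluster rarely boosts the `b–c`
disconnection by much: `P(C_a ∌ b,c and μ_{G−C_a}(b↮c) ≥ λ U) ≤ λ⁻²`; its extreme case `λ U = 1` ("`C_a` separates `b` from `c`") is
exactly the van den Berg–Kesten inequality for the two DISJOINT closed cuts of `∂C_a` facing `b` and facing `c`.  (ii) Evidence (seat
prim-consts-1 gen 15, exact rationals): kit job j175668 — all 6 026 graphs of {connected graphs on ≤ 5 vertices with ≤ 10 edges, connected
6-vertex graphs with ≤ 6 edges, 300 random connected multigraphs on ≤ 7 vertices}, every root `a` and pair `{b,c}`, 7 weight vectors each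
(uniform 1/2, 1/10, 9/10, dyadic/corner mixes, random): 2 347 170 exact checks, 0 violations; the normalised slack
`R = (T − U·s)/(U·J)`, `J = μ(a joined to exactly one of b, c)` (CSQ ⟺ `R ≤ 1`), has maximum `48941802/172824773 ≈ 0.2832` there
(a 7-vertex graph with one cycle, `w ≡ 9/10`), `≤ 0.29` over cycles, wheels, `K₄, K₅, K_{2,n}`, theta graphs and trees (where it depends on
`p` only and tends to `1/4`, the AM–GM value of the extreme regimes) and `≤ 0.27` under adversarial hill-climbing of the weights; the
fibrewise COUNT form of CSQ (three copies, coefficientwise Bernstein positivity) holds at all 328 863 placements with ≤ 7 edges of that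
census and on all `4¹⁰` fibres of the obstruction graph `G₇` below; the single-edge Bernstein middle coefficient of `U² − T` is `≥ 0` in
7 896 exact edge checks.
(iii) NEGATIVE METHOD RESULTS recorded with the memo (exhaustive AND–OR searches, `eng/c/*.c` of the seat): Gladkov-style ONLINE
hybrid injections (decision trees assigning, before each edge is revealed, a permutation of the three copies) realise
`X × X × Ω ↪ D_a × U_bc × U_bc` on NO graph containing the 3-star (so DUU itself is out of reach of that method, and TS fails on `K₂,₃`),
whereas for CSQ they exist on every graph with ≤ 6 edges tested but NOT on `G₇ = {a~y₁..y₄, b~y₁,y₂,y₃, c~y₂,y₃,y₄}`; the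
two-configuration decision-tree BK form (Gladkov Thm 4.3) also fails on `G₇`.  So a proof of CSQ must be "offline" (Hall / BK-type).

References: N. Gladkov, *Percolation inequalities and decision trees*, arXiv:2408.08457 (2024), Lemma 3.1, Thm. 4.3, Thm. 5.2, Cor. 5.3;
J. van den Berg, O. Häggström, J. Kahn, Random Structures Algorithms 29 (2006) 417–435, Lemma 2.4; J. van den Berg, H. Kesten,
J. Appl. Probab. 22 (1985) 556–569.
-/

noncomputable section

namespace Summit.CriticalPhenomena.PercolationContinuityZ3.Theorems

open MeasureTheory Set Literature.Probability.LatticeModels Literature.Probability.Percolation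
open Literature.Probability.Percolation.BHK2006
open Literature.Probability.Percolation.DecisionTree (ind ind_of_mem ind_of_not_mem ind_nonneg)
open scoped Classical

namespace Consts

/-! ### The objects -/

/-- `u(ω)`: the probability that `b` and `c` are separated in a fresh configuration from which every pair meeting `{a} ∪ V(C_a(ω))`
has been deleted — percolation on `G − C_a(ω)` (van den Berg–Häggström–Kahn's half-step given the cluster of `a`).
[cite: VandenbergHaggstromKahn2005, §2.1 Lemma 2.4 (p. 10)] -/
def sepOffCluster {n : ℕ} (w : Sym2 (Fin n) → unitInterval) (a b c : Fin n) (ω : BondConfig (Fin n)) : ℝ :=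
  (prodBernoulli w).real {η | ¬ (openGraph (η \ barOf {a} (setCl ω {a}))).Reachable b c}

/-- `T = ∫_{D_a} u² dμ = Σ_K P(C_a = K, K ∌ b,c) · μ_{G−K}(b ↮ c)²` — the "cluster square" of the triple `(a; b, c)`.
[cite: Gladkov2024, Thm. 5.2 (the sum `Σ_N δ(N) P(B | N)²` over the leaves of the tree exploring `C_a`)] -/
def clusterSquare {n : ℕ} (w : Sym2 (Fin n) → unitInterval) (a b c : Fin n) : ℝ :=
  ∫ ω in (openConn a b)ᶜ ∩ (openConn a c)ᶜ, sepOffCluster w a b c ω ^ 2 ∂(prodBernoulli w)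

/-- **CONJECTURE (CSQ) — the cluster-square inequality.**  For every finite weighted graph (`Fin n`, weights `w`,
`μ = prodBernoulli w`) and vertices `a, b, c`:
`∫_{a↮b, a↮c} μ{b ↮ c off C_a(ω)}² dμ(ω) ≤ μ(b ↮ c)²`, i.e. `Σ_K P(C_a = K, K ∌ b,c)·μ_{G−K}(b↮c)² ≤ μ_G(b↮c)²`;
equivalently, for two independent configurations `η, ω''`, `P(η ∈ a|b|c and b ↮ c in ω'' off C_a(η)) ≤ P(b ↮ c)²`.
OPEN (conjectured in this programme, PAPER-2 consts track, seat prim-consts-1 gen 15, 2026-08-23; evidence: exact census kit j175668,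
2 347 170 checks on 6 026 graphs, 0 violations, normalised slack `(T − U s)/(U J) ≤ 0.284 < 1` (≤ 0.29 in every family and adversarial
search tried); fibrewise count form verified at 328 863 placements and on the obstruction graph `G₇`).  It implies `Consts.RootedSplit` (DUU) by the kernel Cauchy–Schwarz step
`Consts.sq_real_split_le_real_mul_clusterSquare` (`Consts.rootedSplit_of_clusterSquareSplit`), hence `Consts.TripleSplit`.
Its extreme case (the cluster of `a` separates `b` from `c`) is the van den Berg–Kesten inequality; decision-tree (online) hybrid proofs
of it do not exist on the 7-vertex graph `G₇` of the file docstring, so a proof must be of BK/Hall type.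
builds on p205010 (kernel theorem, internal audit signed; external expert review pending).
[cite: Gladkov2024, Thm. 5.2 and Cor. 5.3 (the Cauchy–Schwarz pattern); Thm. 4.3 (decision-tree vdBK)] [status: open] -/
@[conjecture] def ClusterSquareSplit : Prop :=
  ∀ (n : ℕ) (w : Sym2 (Fin n) → unitInterval) (a b c : Fin n),
    clusterSquare w a b c ≤ (prodBernoulli w).real (openConn b c)ᶜ ^ 2

/-! ### Finite-sum bookkeeping -/

section Sums

variable {n : ℕ}

/-- The real weights of `w`. [folklore] -/
private def wr (w : Sym2 (Fin n) → unitInterval) : Sym2 (Fin n) → ℝ := fun e => (w e : ℝ)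

/-- The weights are `≥ 0`. [folklore] -/
private theorem wr_nonneg (w : Sym2 (Fin n) → unitInterval) (e : Sym2 (Fin n)) : 0 ≤ wr w e := (w e).2.1

/-- The weights are `≤ 1`. [folklore] -/
private theorem wr_le_one (w : Sym2 (Fin n) → unitInterval) (e : Sym2 (Fin n)) : wr w e ≤ 1 := (w e).2.2

/-- `μ(S) = Σ_ω w(ω) 1_S(ω)`. [folklore] -/
private theorem real_eq_sum (w : Sym2 (Fin n) → unitInterval) (S : Set (BondConfig (Fin n))) :
    (prodBernoulli w).real S = ∑ ω, weight (wr w) ω * ind S ω :=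
  prodBernoulli_real_eq_sum_weight_ind w S

/-- `∫_S g dμ = Σ_ω w(ω) g(ω) 1_S(ω)`. [folklore] -/
private theorem setIntegral_eq_sum (w : Sym2 (Fin n) → unitInterval) (S : Set (BondConfig (Fin n)))
    (g : BondConfig (Fin n) → ℝ) :
    ∫ ω in S, g ω ∂(prodBernoulli w) = ∑ ω, weight (wr w) ω * (g ω * ind S ω) := by
  rw [← integral_indicator MeasurableSet.of_discrete, integral_prodBernoulli_eq_sum]
  refine Finset.sum_congr rfl fun ω _ => ?_
  by_cases hω : ω ∈ S
  · rw [Set.indicator_of_mem hω, ind_of_mem hω, mul_one]; rfl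
  · rw [Set.indicator_of_notMem hω, ind_of_not_mem hω]; simp

/-- `Σ_ω w(ω) = 1`. [folklore] -/
private theorem sum_weight (w : Sym2 (Fin n) → unitInterval) : ∑ ω, weight (wr w) ω = 1 := by
  have h := real_eq_sum w Set.univ
  simp only [probReal_univ, ind_of_mem (Set.mem_univ _), mul_one] at h
  exact h.symm

/-- `{b ↮ c}` read off the set cluster `C_{{b,c}}`. [cite: VandenbergHaggstromKahn2005, §1 p. 3] -/
private theorem not_reachable_iff_setCl (ζ : BondConfig (Fin n)) (b c : Fin n) :
    ¬ (openGraph ζ).Reachable b c ↔ ¬ (openGraph (setCl ζ {b, c})).Reachable b c := by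
  rw [KNSep.reachable_iff_cluster ζ {b, c} (Set.mem_insert b {c}) c]
  rfl

end Sums

/-! ### The tower identity and the Cauchy–Schwarz step -/

/-- **Tower identity** (conditioning on the cluster of `a`): `μ(a|b|c) = ∫_{a↮b, a↮c} μ{b ↮ c off C_a(ω)} dμ(ω)`.
[cite: VandenbergHaggstromKahn2005, §2.1 Lemma 2.4 (p. 10), summed (`BHK2006.set_sum_cond_cluster`)] -/
theorem real_split_eq_setIntegral_sepOffCluster {n : ℕ} (w : Sym2 (Fin n) → unitInterval) (a b c : Fin n) :
    (prodBernoulli w).real ((openConn a b)ᶜ ∩ (openConn a c)ᶜ ∩ (openConn b c)ᶜ) =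
      ∫ ω in (openConn a b)ᶜ ∩ (openConn a c)ᶜ, sepOffCluster w a b c ω ∂(prodBernoulli w) := by
  set D : Set (BondConfig (Fin n)) := (openConn a b)ᶜ ∩ (openConn a c)ᶜ with hDdef
  -- `h(B) = 1{b ↮ c in the edge set B}`
  set h : Set (Sym2 (Fin n)) → ℝ := fun B => if (openGraph B).Reachable b c then 0 else 1 with hh
  have hD : ∀ ω, ω ∈ D ↔ ∀ s ∈ ({a} : Set (Fin n)), ∀ t ∈ ({b, c} : Set (Fin n)),
      ¬ (openGraph ω).Reachable s t := by
    intro ω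
    simp only [hDdef, Set.mem_inter_iff, Set.mem_compl_iff, openConn, Set.mem_setOf_eq, Set.mem_singleton_iff,
      Set.mem_insert_iff, forall_eq_or_imp, forall_eq]
  -- `1_{b↮c}(ζ) = h(C_{{b,c}}(ζ))`
  have hind : ∀ ζ : BondConfig (Fin n), ind (openConn b c)ᶜ ζ = h (setCl ζ {b, c}) := by
    intro ζ
    by_cases hbc : (openGraph ζ).Reachable b c
    · have h1 : (openGraph (setCl ζ {b, c})).Reachable b c := by
        by_contra h2; exact ((not_reachable_iff_setCl ζ b c).2 h2) hbc
      rw [ind_of_not_mem (show ζ ∉ (openConn b c)ᶜ from fun h' => h' hbc), hh]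
      simp only [h1, if_true]
    · have h1 : ¬ (openGraph (setCl ζ {b, c})).Reachable b c := (not_reachable_iff_setCl ζ b c).1 hbc
      rw [ind_of_mem (show ζ ∈ (openConn b c)ᶜ from hbc), hh]
      simp only [h1, if_false]
  have key := set_sum_cond_cluster (wr w) (sum_weight w) {a} {b, c} (fun _ B => h B) hD
  -- the inner sum is `u(ω)`
  have hu : ∀ ω : BondConfig (Fin n),
      ∑ η, weight (wr w) η * h (setCl (η \ barOf {a} (setCl ω {a})) {b, c}) = sepOffCluster w a b c ω := by
    intro ω
    rw [sepOffCluster, real_eq_sum]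
    refine Finset.sum_congr rfl fun η _ => ?_
    rw [← hind]
    rfl
  rw [real_eq_sum, setIntegral_eq_sum]
  have lhs : ∑ ω, weight (wr w) ω * ind (D ∩ (openConn b c)ᶜ) ω =
      ∑ ω, weight (wr w) ω * (h (setCl ω {b, c}) * ind D ω) :=
    Finset.sum_congr rfl fun ω _ => by rw [ind_inter, hind, mul_comm (ind D ω)]
  rw [lhs, key]
  exact Finset.sum_congr rfl fun ω _ => by rw [hu]

/-- `0 ≤ u(ω)`. [folklore] -/
theorem sepOffCluster_nonneg {n : ℕ} (w : Sym2 (Fin n) → unitInterval) (a b c : Fin n) (ω : BondConfig (Fin n)) :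
    0 ≤ sepOffCluster w a b c ω := measureReal_nonneg

/-- `u(ω) ≤ 1`. [folklore] -/
theorem sepOffCluster_le_one {n : ℕ} (w : Sym2 (Fin n) → unitInterval) (a b c : Fin n) (ω : BondConfig (Fin n)) :
    sepOffCluster w a b c ω ≤ 1 := measureReal_le_one

/-- **`T ≤ s`**: the cluster square is at most `μ(a|b|c)` (since `u ≤ 1`), so the cluster-square inequality `T ≤ U²` is automatic
in the regime `μ(a|b|c) ≤ μ(b↮c)²`; its content is in the regime `U² < s ≤ U`. [folklore] -/
theorem clusterSquare_le_real_split {n : ℕ} (w : Sym2 (Fin n) → unitInterval) (a b c : Fin n) :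
    clusterSquare w a b c ≤ (prodBernoulli w).real ((openConn a b)ᶜ ∩ (openConn a c)ᶜ ∩ (openConn b c)ᶜ) := by
  set D : Set (BondConfig (Fin n)) := (openConn a b)ᶜ ∩ (openConn a c)ᶜ with hDdef
  rw [real_split_eq_setIntegral_sepOffCluster, clusterSquare, setIntegral_eq_sum, setIntegral_eq_sum]
  refine Finset.sum_le_sum fun ω _ => mul_le_mul_of_nonneg_left ?_ (weight_nonneg (wr_nonneg w) (wr_le_one w) ω)
  refine mul_le_mul_of_nonneg_right ?_ (ind_nonneg D ω)
  have h0 := sepOffCluster_nonneg w a b c ω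
  have h1 := sepOffCluster_le_one w a b c ω
  nlinarith

/-- **KERNEL (Cauchy–Schwarz over the cluster of `a`).**  `μ(a|b|c)² ≤ μ(a↮b, a↮c) · ∫_{a↮b,a↮c} μ{b↮c off C_a}² dμ`, i.e.
`s² ≤ D · T` with `T = Consts.clusterSquare`.
[cite: Gladkov2024, Thm. 5.2 (inequality (7) and its proof: Cauchy–Schwarz on the vectors `√δ(N)`, `√δ(N) P(B|N)`)] -/
theorem sq_real_split_le_real_mul_clusterSquare {n : ℕ} (w : Sym2 (Fin n) → unitInterval) (a b c : Fin n) :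
    (prodBernoulli w).real ((openConn a b)ᶜ ∩ (openConn a c)ᶜ ∩ (openConn b c)ᶜ) ^ 2 ≤
      (prodBernoulli w).real ((openConn a b)ᶜ ∩ (openConn a c)ᶜ) * clusterSquare w a b c := by
  set D : Set (BondConfig (Fin n)) := (openConn a b)ᶜ ∩ (openConn a c)ᶜ with hDdef
  rw [real_split_eq_setIntegral_sepOffCluster, clusterSquare, setIntegral_eq_sum, setIntegral_eq_sum, real_eq_sum]
  have hwt : ∀ ω : BondConfig (Fin n), 0 ≤ weight (wr w) ω := weight_nonneg (wr_nonneg w) (wr_le_one w)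
  exact Finset.sum_sq_le_sum_mul_sum_of_sq_le_mul Finset.univ (fun ω _ => mul_nonneg (hwt ω) (ind_nonneg D ω))
    (fun ω _ => mul_nonneg (hwt ω) (mul_nonneg (sq_nonneg _) (ind_nonneg D ω))) fun ω _ => le_of_eq (by ring)

/-! ### Consequences of the conjecture -/

/-- **CSQ ⟹ DUU**: the cluster-square inequality implies the rooted split inequality `μ(a|b|c)² ≤ μ(a↮b,a↮c)·μ(b↮c)²`.
[cite: Gladkov2024, Thm. 5.2 / Cor. 5.3 (the same two-step pattern: Cauchy–Schwarz over the cluster of `a`, then a two-copy bound)] -/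
theorem rootedSplit_of_clusterSquareSplit (h : ClusterSquareSplit) : RootedSplit := by
  intro n w a b c
  have h1 := sq_real_split_le_real_mul_clusterSquare w a b c
  have h2 : (prodBernoulli w).real ((openConn a b)ᶜ ∩ (openConn a c)ᶜ) * clusterSquare w a b c ≤
      (prodBernoulli w).real ((openConn a b)ᶜ ∩ (openConn a c)ᶜ) * (prodBernoulli w).real (openConn b c)ᶜ ^ 2 :=
    mul_le_mul_of_nonneg_left (h n w a b c) measureReal_nonneg
  exact h1.trans h2

/-- **CSQ ⟹ TS**: the cluster-square inequality implies the triple-split inequality `μ(a|b|c)² ≤ μ(a↮b)μ(a↮c)μ(b↮c)`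
(through `Consts.tripleSplit_of_rootedSplit`). [cite: Gladkov2024, Thm. 5.2] -/
theorem tripleSplit_of_clusterSquareSplit (h : ClusterSquareSplit) : TripleSplit :=
  tripleSplit_of_rootedSplit (rootedSplit_of_clusterSquareSplit h)

end Consts

end Summit.CriticalPhenomena.PercolationContinuityZ3.Theorems
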